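import Summits.CriticalPhenomena.PercolationContinuityZ3.Theorems.Transplant.PlanarSkeletonDefs
import HarnessLib

/-!
# THE CONSTANT CHART: every quasi-transitive graph carries the bare `PlanarSkeleton` `φ ≡ 0` — so the bare interface has NO geometric content
# of its own, and on that chart the side conditions of the named node `SamePWitnessOfSkeleton` (Φ2 `CylSubcritical p` and `θ_t(p) > 0`) are
# CONTRADICTORY (refuter's vacuity census of the open bare-skeleton nodes)

builds on p205010 (kernel theorem, internal audit signed; external expert review pending) — nothing in this file uses p205010; nothing is claimed
about any open node (this is a remark about an INTERFACE, kernel-checked).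
Lane `prim-bschramm-*`, seat `prim-bschramm-p5` (gen 23; refuter / sharpness search; memo `HOME/P5-SHARPNESS.md` §53); helper file
(`--supports stmt-CriticalPhenomena-4575 --as helper`).

THE OBSERVATION.  The bare interface `PlanarSkeleton G` (fields `φ`, `lip`, `types`, `frame`, `point` — no unit steps, no connected cylinders, no
degree bound) is satisfied on EVERY quasi-transitive graph by the ZERO chart `φ ≡ 0`: `lip` is `|0 − 0| ≤ 1`, the frames are the automorphisms that
quasi-transitivity provides (they translate `0` by `0`), and the point group `HOct 2` lifts to the identity (`sp g 0 = 0`).  On this chart every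
cylinder is the whole vertex set, so Φ2 at `p` says `θ_t(p) = 0` on `G.induce univ ≃g G`, i.e. `θ_t(p) = 0` on `G` — which contradicts the node's
other hypothesis `0 < θ_t(p)`.  Consequences for the ledger (P5-SHARPNESS §53): (1) `Nonempty (PlanarSkeleton G)` for every quasi-transitive `G`
carries no information — non-vacuity witnesses for the bare nodes (`SamePWitnessOfSkeleton`, `SamePDropOfSkeleton`, `SkeletonCriticalContinuity`)
must exhibit a chart on which `CylSubcritical p ∧ 0 < θ_t(p)` is SATISFIABLE (thin cylinders: `p_c(cyl_ℓ) > p_c(G)` for all `ℓ` — e.g. ℤ³ with the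
two-coordinate chart, `Zd3PlanarSkeleton`), never merely a skeleton; (2) the interfaces WITH unit steps (`PlanarSkeletonFrm/Neg/Sign/Conc`, (ι))
exclude the zero chart — (ι) is what gives those nodes geometric teeth (`PlanarSkeletonFrm.superlinear_growth`, `SharpnessCarriersNoFrm`).
* `PlanarSkeleton.sp_apply_zero`, **`PlanarSkeleton.exists_const`** / `nonempty_of_isQuasiTransitive` (the zero chart on a quasi-transitive graph),
  `mem_cyl_of_const` (cylinders = everything), `theta_induce_of_forall_mem`, **`sideConditions_absurd_of_const`**, `exists_skeleton_sideConditions_absurd`.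
  THEOREMS ONLY (no `def`): the chart is exhibited existentially.
[cite: KozmaNitzan2024, §4 p. 15 (boxes and the role of the lattice symmetries)] [cite: BenjaminiSchramm1996, §2 (quasi-transitive graphs)]
-/

noncomputable section

namespace Summit.CriticalPhenomena.PercolationContinuityZ3.Theorems.Transplant

namespace PlanarSkeleton

open Literature.Probability.Percolation Literature.Probability.LatticeModels
open Literature.Probability.Percolation.GM
open Literature.Barriers.CriticalPhenomena (IsQuasiTransitive)
open scoped Classical

variable {V : Type} {G : SimpleGraph V}

/-- The signed coordinate permutations fix the origin. [folklore] -/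
theorem sp_apply_zero (g : HOct 2) : sp g (0 : Site 2) = 0 := by
  funext i; simp [Site.signedPerm_apply]

/-- **THE ZERO CHART EXISTS**: every quasi-transitive graph carries a bare planar skeleton with `φ ≡ 0` (base set = a finite set of orbit
representatives, frames = the automorphisms of quasi-transitivity, point group = the identity). [cite: BenjaminiSchramm1996, §2 (quasi-transitive graphs)] -/
theorem exists_const (hq : IsQuasiTransitive G) : ∃ Φ : PlanarSkeleton G, ∀ v : V, Φ.φ v = 0 := by
  obtain ⟨V₀, hV₀⟩ := hq
  refine ⟨⟨fun _ => 0, fun _ _ _ _ => (by simp), V₀, fun v => ?_,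
    fun t _ g => ⟨RelIso.refl _, rfl, fun w => (by simp only [sub_self, sp_apply_zero])⟩⟩, fun _ => rfl⟩
  obtain ⟨γ, hγ⟩ := hV₀ v
  exact ⟨γ v, hγ, γ.symm, by rw [RelIso.symm_apply_apply], fun w => by simp⟩

/-- In particular `Nonempty (PlanarSkeleton G)` for EVERY quasi-transitive graph — the bare interface has no geometric content of its own.
[cite: BenjaminiSchramm1996, §2 (quasi-transitive graphs)] -/
theorem nonempty_of_isQuasiTransitive (hq : IsQuasiTransitive G) : Nonempty (PlanarSkeleton G) :=
  let ⟨Φ, _⟩ := exists_const hq; ⟨Φ⟩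

/-- Every cylinder of a constant chart is the whole vertex set. [folklore] -/
theorem mem_cyl_of_const (Φ : PlanarSkeleton G) (h0 : ∀ v : V, Φ.φ v = 0) (t : V) (ℓ : ℕ) (w : V) : w ∈ Φ.cyl t ℓ := by
  rw [PlanarSkeleton.mem_cyl, h0, h0, sub_self]; exact zero_mem_box 2 ℓ

/-- `θ` on the graph induced on a set containing EVERY vertex is `θ` on the graph (transport along the tautological isomorphism). [folklore] -/
theorem theta_induce_of_forall_mem [Countable V] (S : Set V) (hS : ∀ w, w ∈ S) (t : V) (ht : t ∈ S) (p : unitInterval) :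
    theta (G.induce S) ⟨t, ht⟩ p = theta G t p := by
  let e : G.induce S ≃g G := ⟨Equiv.subtypeUnivEquiv hS, Iff.rfl⟩
  have h := theta_iso e ⟨t, ht⟩ p
  exact h.symm

/-- **On a constant chart the side conditions of `SamePWitnessOfSkeleton` are contradictory**: Φ2 at `p` (every cylinder — here the whole graph —
has `θ = 0` at `p`) and `0 < θ_t(p)` cannot both hold at a base vertex.  So `Nonempty (PlanarSkeleton G)` is no non-vacuity witness for the bare
nodes; a witness must make `CylSubcritical p ∧ 0 < θ_t(p)` satisfiable (thin cylinders). [cite: KozmaNitzan2024, §4 p. 15] -/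
theorem sideConditions_absurd_of_const [Countable V] [G.LocallyFinite] (Φ : PlanarSkeleton G) (h0 : ∀ v : V, Φ.φ v = 0) {p : unitInterval}
    {t : V} (ht : t ∈ Φ.types) (hC : Φ.CylSubcritical p) (hθ : 0 < theta G t p) : False := by
  have h := hC t ht 0
  rw [theta_induce_of_forall_mem (Φ.cyl t 0) (mem_cyl_of_const Φ h0 t 0) t _ p] at h
  exact absurd h (ne_of_gt hθ)

/-- **Hence on every quasi-transitive graph SOME bare planar skeleton makes the bare node's hypotheses unsatisfiable at every density** — the
content of `SamePWitnessOfSkeleton` / `SamePDropOfSkeleton` lies entirely in the chart-dependent side conditions, not in the interface.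
[cite: KozmaNitzan2024, §4 p. 15] [cite: BenjaminiSchramm1996, §2] -/
theorem exists_skeleton_sideConditions_absurd [Countable V] [G.LocallyFinite] (hq : IsQuasiTransitive G) :
    ∃ Φ : PlanarSkeleton G, ∀ (p : unitInterval) (t : V), t ∈ Φ.types → Φ.CylSubcritical p → ¬ 0 < theta G t p := by
  obtain ⟨Φ, h0⟩ := exists_const hq
  exact ⟨Φ, fun p t ht hC hθ => sideConditions_absurd_of_const Φ h0 ht hC hθ⟩

end PlanarSkeleton

end Summit.CriticalPhenomena.PercolationContinuityZ3.Theorems.Transplant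

end
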